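import Literature.AlgebraicGeometry.HodgeTheory.GAGACechH1Comparison
import Literature.AlgebraicGeometry.Morphisms.CechH1AffineCoverIndependence
import Literature.AlgebraicGeometry.HodgeTheory.JacobianHodgeGenus
import Literature.AlgebraicGeometry.HodgeTheory.ProjectiveFiniteAffineCover
import Literature.AlgebraicGeometry.Motives.GAGAKaehlerImmersionProofs
import Literature.AlgebraicGeometry.Motives.HodgeDecompositionDolbeaultComparisonDischarge
import Literature.AlgebraicGeometry.HodgeTheory.HodgeStructureOfHodgeModel
import Literature.AlgebraicGeometry.HodgeTheory.HodgeFiltrationModelsReductionProofs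
import Literature.AlgebraicGeometry.HodgeTheory.HypersurfaceHolomorphicForms
import Literature.AlgebraicGeometry.HodgeTheory.ComplexConjugationHolds
import HarnessLib

/-!
# `dim_ℂ Ȟ¹(𝔘, 𝒪_{A₀}) ≤ dim A₀` for a complex abelian variety (Zariski–Čech form of `h¹(𝒪_A) ≤ g`)

D. Mumford, *Abelian Varieties* (1970), §1 (4) and §13 (Cor. 2, p. 129: `H¹(A, 𝒪_A)` has dimension `g`); here the
INEQUALITY `dim Ȟ¹(𝔘, 𝒪_{A₀}) ≤ dim A₀` for the Čech cohomology of the structure sheaf on a finite affine open cover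
`𝔘` of a complex abelian variety `A₀`, which is what the Mumford §13 road to the universal property of the Poincaré
bundle consumes (cell hodgecm-mathlib, M13 node N3e; the socket `socket_N3e_cechH1_finrank_le` of the N3
assembly). Proof (GAGA + Hodge theory, everything already in the tree):

1. `AbelianVariety.finrank_cechH1_structureSheaf_le_dim` — for a cover with locally-one-equation complements:
   GAGA-injectivity `Ȟ¹(𝔘, 𝒪) ↪ Ȟ¹(𝔘^an, 𝒪^an)` (`GAGACechH1Comparison.finrank_cechH1_le_of_analyticModel`,
   Serre), Leray for the affine (Stein) cover (`AnalyticModel.nonempty_dolbeaultCohomology_equiv_cech`: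
   `Ȟ¹(𝔘^an, 𝒪^an) ≅ H^{0,1}_∂̄(A₀^an)`), the Dolbeault–Hodge comparison on the compact Kähler manifold `A₀^an`
   (`exists_hodgePQ_equiv_dolbeaultCohomology_holds`) and `h^{0,1}(A₀) = dim A₀`
   (`AbelianVariety.finrank_hodgeZeroOne_eq_dim`);
2. `AbelianVariety.finrank_cechH1_structureSheaf_le_dim_of_isAffineOpen` — on EVERY finite affine open cover,
   by cover independence of `Ȟ¹` of a quasi-coherent sheaf (`Morphisms.finite_and_finrank_cechH1_le_of_isAffineOpen`,
   Hartshorne III Thm. 4.5) applied to the standard cover of a projective embedding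
   (`Morphisms.exists_isAffineOpen_cover_inf_eq_basicOpen_of_isProjectiveOver`);
3. `AbelianVariety.socket_N3e_cechH1_finrank_le_holds` — the displayed body of the N3 assembly's socket, verbatim.

Everything here is proved; no definitions, no named facts.

## References

* [MumfordAV1970] D. Mumford, Abelian Varieties (1970), §1 (4); §13 Cor. 2 (p. 129).
* [SerreGAGA1956] J.-P. Serre, Géométrie algébrique et géométrie analytique, Ann. Inst. Fourier 6 (1956),
  n° 12 Théorème 1 (p. 19).
* [Hartshorne1977] R. Hartshorne, Algebraic Geometry (1977), III Thm. 4.5 (p. 222).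
* [VoisinHodgeI2002] C. Voisin, Hodge Theory and Complex Algebraic Geometry I (2002), §4.3 Cor. 4.38, §6.1
  (Hodge decomposition and Dolbeault cohomology).
-/

noncomputable section

open scoped Manifold ContDiff Topology
open CategoryTheory AlgebraicGeometry Set TopologicalSpace
open Literature.AlgebraicGeometry.Motives (AlgPoints ComplexPoints SchemeOver IsSmoothProjective)
open Literature.Geometry.Kaehler Literature.Algebra.Homology Literature.AlgebraicGeometry.Morphisms
open Literature.NumberTheory.Transcendental

namespace Literature.AlgebraicGeometry.HodgeTheory

universe u

section AbelianVarietyBound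

/-- **`h¹(𝒪) ≤ g` for a complex abelian variety, Zariski–Čech form: `finrank ℂ Ȟ¹(𝔘, 𝒪_{A₀}) ≤ dim A₀`**
(and `Ȟ¹(𝔘, 𝒪_{A₀})` is finite-dimensional) for every finite affine open cover `𝔘` of `A₀` whose members have
locally-one-equation complements (e.g. the non-vanishing loci `A₀_σ` of sections of a line bundle). Proof:
GAGA-injectivity `Ȟ¹(𝔘, 𝒪) ↪ Ȟ¹(𝔘^an, 𝒪^an)` (`finrank_cechH1_le_of_analyticModel`, Serre's Prop. 15,
holomorphe ⇒ régulière), Leray's theorem for the affine cover (`AnalyticModel.nonempty_dolbeaultCohomology_equiv_cech`: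
`Ȟ¹(𝔘^an, 𝒪^an) ≅ H^{0,1}_∂̄`), the Dolbeault–Hodge comparison on the compact Kähler manifold `A₀^an`
(`exists_hodgePQ_equiv_dolbeaultCohomology_holds`) and `h^{0,1}(A₀) = dim A₀`
(`AbelianVariety.finrank_hodgeZeroOne_eq_dim`). This is the crux (3e) of the Mumford §13 road to the universal
property of the Poincaré bundle. [cite: MumfordAV1970, §1 (4) and §13] [cite: SerreGAGA1956, n° 12 Théorème 1] -/
theorem AbelianVariety.finrank_cechH1_structureSheaf_le_dim (A₀ : Literature.AlgebraicGeometry.Motives.AbelianVariety ℂ)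
    {ι : Type} [Finite ι] (U : ι → A₀.X.left.Opens) (hcov : ⨆ i, U i = ⊤) (haff : ∀ i, IsAffineOpen (U i))
    (hU : ∀ (i : ι) (x : A₀.X.left), ∃ (W : A₀.X.left.Opens) (b : Γ(A₀.X.left, W)),
      x ∈ W ∧ W ⊓ U i = A₀.X.left.basicOpen b) :
    Module.Finite ℂ (CechH1 A₀.X.hom U) ∧ Module.finrank ℂ (CechH1 A₀.X.hom U) ≤ A₀.dim := by
  classical
  have hX : IsSmoothProjective A₀.dim A₀.X := Literature.AlgebraicGeometry.Motives.AbelianVariety.isSmoothProjective_holds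
  obtain ⟨B⟩ := nonempty_hodgeModel_holds.nonempty hX
  haveI : SmoothOfRelativeDimension A₀.dim A₀.X.hom := hX.smoothOfRelativeDimension
  haveI : Fintype ι := Fintype.ofFinite ι
  haveI : A₀.X.left.IsSeparated := isSeparated_left_of_isSmoothProjective hX
  haveI : IsAffineCover U := isAffineCover_of_isAffineOpen haff
  haveI : CompactSpace B.carrier := B.compactSpace_carrier hX
  haveI : IsKaehlerManifold B.model B.carrier := by
    obtain ⟨N, ιN, hιN⟩ := hX.isProjectiveOver
    exact Literature.AlgebraicGeometry.Motives.isKaehlerManifold_of_isAnalytification_of_isClosedImmersion_holds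
      (X := A₀.X) (d := A₀.dim) (E := B.model) (M := B.carrier) (φ := B.toComplexPoints) ιN B.isAnalytification
  -- Leray for the affine cover and the Dolbeault–Hodge comparison, in bidegree `(0, 1)`
  obtain ⟨eL⟩ := B.toAnalyticModel.nonempty_dolbeaultCohomology_equiv_cech U hcov 0 1
  have eL' : dolbeaultCohomology B.model B.carrier 0 1 ≃ₗ[ℂ] NatCochain.Cohomology (R := ℂ)
      (A := CechHolForms B.model B.toAnalyticModel.carrier (B.toAnalyticModel.coverSet U)
        (B.toAnalyticModel.isOpen_coverSet U) 0)
      (cechHolδ B.model B.toAnalyticModel.carrier (B.toAnalyticModel.isOpen_coverSet U) 0) 1 := eL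
  obtain ⟨eD, -⟩ := Literature.AlgebraicGeometry.Motives.exists_hodgePQ_equiv_dolbeaultCohomology_holds
    (E := B.model) (M := B.carrier) 0 1
  have eD' : ↥(hodgePQ B.model B.carrier 1 0 1) ≃ₗ[ℂ] dolbeaultCohomology B.model B.carrier 0 1 := eD
  -- `H^{0,1}` of the model inside `H¹(A₀^an; ℂ)` and inside `H¹(A₀(ℂ); ℂ)`
  let eR : ↥(hodgePQ B.model B.carrier 1 0 1) ≃ₗ[ℂ] ↥(B.hodgePQ 1 0 1) :=
    (B.deRham B.carrier 1).submoduleMap (hodgePQ B.model B.carrier 1 0 1)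
  haveI : FiniteDimensional ℂ (complexBetti A₀.X 1) :=
    (Literature.AlgebraicGeometry.Motives.abelianVarietyCohomologyExteriorH1_holds A₀).1
  haveI : Module.Finite ℂ (Literature.AlgebraicTopology.SingularHomology.singularCohomology ℂ ℂ B.carrier 1) :=
    LinearEquiv.finiteDimensional (B.pullbackEquiv 1)
  haveI hfinPQ : Module.Finite ℂ ↥(hodgePQ B.model B.carrier 1 0 1) := Module.Finite.equiv eR.symm
  haveI : Module.Finite ℂ (dolbeaultCohomology B.model B.carrier 0 1) := Module.Finite.equiv eD'
  haveI : Module.Finite ℂ (NatCochain.Cohomology (R := ℂ)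
      (A := CechHolForms B.model B.toAnalyticModel.carrier (B.toAnalyticModel.coverSet U)
        (B.toAnalyticModel.isOpen_coverSet U) 0)
      (cechHolδ B.model B.toAnalyticModel.carrier (B.toAnalyticModel.isOpen_coverSet U) 0) 1) :=
    Module.Finite.equiv eL'
  -- `H^{0,1}` read on `H¹(A₀(ℂ); ℂ)` is `hodgeZeroOne` (independence of the Hodge model)
  have hmem : ∀ c : complexBetti A₀.X 1, c ∈ hodgeZeroOne hX ↔ B.pullback 1 c ∈ B.hodgePQ 1 0 1 := fun c ↦ by
    constructor
    · rintro ⟨B', hB'⟩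
      exact hodgePQ_independent_of_hodgeModel_holds _ _ hX B' B 1 0 1 c hB'
    · intro h
      exact ⟨B, h⟩
  have hcomap : (B.hodgePQ 1 0 1).comap ((B.pullbackEquiv 1 : complexBetti A₀.X 1 ≃ₗ[ℂ] _) :
      complexBetti A₀.X 1 →ₗ[ℂ] Literature.AlgebraicTopology.SingularHomology.singularCohomology ℂ ℂ B.carrier 1) =
      hodgeZeroOne hX :=
    Submodule.ext fun c ↦ by rw [Submodule.mem_comap]; exact (hmem c).symm
  have h4 : Module.finrank ℂ ↥(hodgeZeroOne hX) = Module.finrank ℂ ↥(B.hodgePQ 1 0 1) := by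
    rw [← hcomap, Submodule.comap_equiv_eq_map_symm, LinearEquiv.finrank_map_eq]
  have h5 := AbelianVariety.finrank_hodgeZeroOne_eq_dim A₀ hX
  -- assembly
  obtain ⟨hfin, hle⟩ := finrank_cechH1_le_of_analyticModel B.toAnalyticModel U hX hcov haff hU
  refine ⟨hfin, hle.trans (le_of_eq ?_)⟩
  rw [← eL'.finrank_eq, ← eD'.finrank_eq, eR.finrank_eq, ← h4, h5]

/-! ### (3e) on EVERY finite affine open cover (cover independence) -/

/-- **`h¹(𝔘, 𝒪_{A₀}) ≤ dim A₀` on EVERY finite affine open cover** of a complex abelian variety `A₀`: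
`Ȟ¹(𝔘, 𝒪_{A₀})` is finite-dimensional of dimension at most `dim A₀` for any finite family of affine
opens covering `A₀`. Proof: the bound holds on the standard cover `A₀ ∩ D₊(x_i)` of a projective
embedding, whose complements are locally cut out by one equation
(`Morphisms.exists_isAffineOpen_cover_inf_eq_basicOpen_of_isProjectiveOver` and
`finrank_cechH1_structureSheaf_le_dim`), and `Ȟ¹` of the structure sheaf does not depend on the
affine cover (`Morphisms.finite_and_finrank_cechH1_le_of_isAffineOpen`, Hartshorne III Thm. 4.5).
This is the socket `socket_N3e_cechH1_finrank_le A₀` of the (M13-3) assembly, verbatim.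
[cite: MumfordAV1970, §13 Cor. 2 (p. 129)] [cite: Hartshorne1977, III Thm. 4.5 (p. 222)] -/
theorem AbelianVariety.finrank_cechH1_structureSheaf_le_dim_of_isAffineOpen
    (A₀ : Literature.AlgebraicGeometry.Motives.AbelianVariety ℂ) (ι : Type) [Finite ι]
    (V : ι → A₀.X.left.Opens) (hVaff : ∀ i, IsAffineOpen (V i)) (hV : iSup V = ⊤) :
    Module.Finite ℂ (CechH1 A₀.X.hom V) ∧ Module.finrank ℂ (CechH1 A₀.X.hom V) ≤ A₀.dim := by
  have hX : IsSmoothProjective A₀.dim A₀.X :=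
    Literature.AlgebraicGeometry.Motives.AbelianVariety.isSmoothProjective_holds
  obtain ⟨N, U, hUaff, hU, hUb⟩ :=
    Morphisms.exists_isAffineOpen_cover_inf_eq_basicOpen_of_isProjectiveOver hX.isProjectiveOver
  exact Morphisms.finite_and_finrank_cechH1_le_of_isAffineOpen A₀.X.hom U V hUaff hVaff hU hV
    (AbelianVariety.finrank_cechH1_structureSheaf_le_dim A₀ U hU hUaff hUb)

/-- **The (N3e) socket of the (M13-3) assembly, discharged**: for every complex abelian variety `A₀`,
`∀ ι [Finite ι] (V : ι → Opens A₀), (∀ i, IsAffineOpen (V i)) → ⨆ V = ⊤ →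
Module.Finite ℂ Ȟ¹(V, 𝒪) ∧ finrank_ℂ Ȟ¹(V, 𝒪) ≤ dim A₀` — the displayed body of
`socket_N3e_cechH1_finrank_le A₀`. [cite: MumfordAV1970, §13 Cor. 2 (p. 129)] -/
theorem AbelianVariety.socket_N3e_cechH1_finrank_le_holds
    (A₀ : Literature.AlgebraicGeometry.Motives.AbelianVariety ℂ) :
    ∀ (ι : Type) (_ : Finite ι) (V : ι → A₀.X.left.Opens), (∀ i, IsAffineOpen (V i)) → iSup V = ⊤ →
      Module.Finite ℂ (CechH1 A₀.X.hom V) ∧ Module.finrank ℂ (CechH1 A₀.X.hom V) ≤ A₀.dim :=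
  fun ι _ V hVaff hV => AbelianVariety.finrank_cechH1_structureSheaf_le_dim_of_isAffineOpen A₀ ι V hVaff hV


end AbelianVarietyBound

end Literature.AlgebraicGeometry.HodgeTheory
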